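import Summits.KontsevichZagierPeriods.KontsevichZagierPeriods.Theorems.UnfoldedStokesStokesGenerationFibrewiseRungDimOneRational
import Summits.KontsevichZagierPeriods.KontsevichZagierPeriods.Theorems.UnfoldedStokesStokesGenerationFibrewiseRungAngularSector
import Summits.KontsevichZagierPeriods.KontsevichZagierPeriods.Theorems.UnfoldedStokesStokesGenerationStubSaPartition
import Summits.KontsevichZagierPeriods.KontsevichZagierPeriods.Theorems.UnfoldedStokesStokesGenerationStubSaClampedAngularCertificate
import Summits.KontsevichZagierPeriods.KontsevichZagierPeriods.Theorems.UnfoldedStokesStokesGenerationStubSaArctanFTC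

/-!
# `StokesGeneration` (stmt-KontsevichZagierPeriods-3586), line `fibrewise_stokes` — rung 10b: the semialgebraic angular sector

Crux `Summit.KontsevichZagierPeriods.KontsevichZagierPeriods.Theses.UnfoldedStokes.StokesGeneration`; residual S2 =
`FibrewiseStokesGenerationConjecture`. Rung 10 (lead c5) generalises the dimension-one Baker layer of S2 from polynomial to
SEMIALGEBRAIC data (logarithmic differentials below genus one). This file is the angular half
(`fibStokesDecomposable_saAngularSector`): for a zero-free loop `P = A + iB` on `[0,1]` with `A, B, A′, B′` `ℚ`-semialgebraic and
continuous, `A, B` differentiable on `(0,1)`, and `γ` algebraic, a closed-interval representation with integrand `γ·Im(P′/P)` and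
value `0` is fibrewise-Stokes decomposable — rung 4's root-free argument (p128548) verbatim with functions in place of polynomials:
rational partition (`stub_saPartition`, p132254), re-centred loops `U = aA + bB`, `W = aB − bA` with `a = A(zₖ)`, `b = B(zₖ)`
(algebraic: values of semialgebraic functions at rational points), clamped half-angle certificates
(`stub_saClampedAngularCertificate`, p132762), arctan FTC (`stub_saArctanFTC`, p132092), cone estimate (p127621), polynomial leftover
loop in the fresh variable (p127637) and rung 3 in swapped coordinates (p127613). `2N + 2` elements on `[0,1]²` off the null grid.

References: M. Kontsevich, D. Zagier, *Periods* (2001), §1.1–1.2; J. Ayoub, Ann. of Math. 181 (2015), Conj. 1.1, Rem. 1.5;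
J. Fresán, *Une introduction aux périodes* (2024), Rem. 3.7.
-/

noncomputable section

set_option linter.dupNamespace false

namespace Summit.KontsevichZagierPeriods.KontsevichZagierPeriods.Cruxes.StokesGeneration.FibrewiseStokes

open MeasureTheory Set
open Literature.NumberTheory.Transcendental
open Literature.NumberTheory.Transcendental.KZ
open Literature.ModelTheory.ExponentialFields (IsSemialgebraic)

/-! ## Rung 10b: the semialgebraic angular sector -/

/-- **S2 on the full angular sector for SEMIALGEBRAIC loops (rung 10b; lead c5).** For a zero-free loop `P = A + iB` on
`[0,1]` with `A, B, A′, B′` `ℚ`-semialgebraic and continuous on `[0,1]`, `A, B` differentiable on `(0,1)`, and `γ` real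
algebraic, a closed-interval representation with integrand `γ·Im(P′/P) = γ(A B′ − A′ B)/(A² + B²)` and value `0` is
fibrewise-Stokes decomposable — rung 4's root-free argument verbatim with functions in place of polynomials: rational
partition (`stub_saPartition`), re-centred loops `U = aA + bB`, `W = aB − bA` (`a = A(zₖ)`, `b = B(zₖ)` algebraic values of
semialgebraic functions at rational points), clamped half-angle certificates (`stub_saClampedAngularCertificate`), arctan FTC
(`stub_saArctanFTC`), cone estimate, polynomial leftover loop in the fresh variable and rung 3 in swapped coordinates (landed,
function-based). [cite: KontsevichZagier2001, §1.2] -/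
theorem fibStokesDecomposable_saAngularSector (γ : ℝ) (A B A' B' : ℝ → ℝ) (hγ : IsAlgebraic ℚ γ)
    (hA : IsSemialgebraicFunOn ℚ (Set.pi Set.univ (fun _ : Fin 1 => Set.Icc (0:ℝ) 1)) (fun z => A (z 0))) (hB : IsSemialgebraicFunOn ℚ (Set.pi Set.univ (fun _ : Fin 1 => Set.Icc (0:ℝ) 1)) (fun z => B (z 0)))
    (hA' : IsSemialgebraicFunOn ℚ (Set.pi Set.univ (fun _ : Fin 1 => Set.Icc (0:ℝ) 1)) (fun z => A' (z 0))) (hB' : IsSemialgebraicFunOn ℚ (Set.pi Set.univ (fun _ : Fin 1 => Set.Icc (0:ℝ) 1)) (fun z => B' (z 0)))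
    (hAc : ContinuousOn A (Set.Icc (0:ℝ) 1)) (hBc : ContinuousOn B (Set.Icc (0:ℝ) 1))
    (hA'c : ContinuousOn A' (Set.Icc (0:ℝ) 1)) (hB'c : ContinuousOn B' (Set.Icc (0:ℝ) 1))
    (hAd : ∀ u ∈ Set.Ioo (0:ℝ) 1, HasDerivAt A (A' u) u) (hBd : ∀ u ∈ Set.Ioo (0:ℝ) 1, HasDerivAt B (B' u) u)
    (hAB : ∀ u ∈ Set.Icc (0:ℝ) 1, A u ^ 2 + B u ^ 2 ≠ 0)
    (t : IntegralRep 1) (ht : t.domain = Set.pi Set.univ (fun _ : Fin 1 => Set.Icc (0:ℝ) 1))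
    (hti : ∀ z ∈ Set.pi Set.univ (fun _ : Fin 1 => Set.Icc (0:ℝ) 1), t.integrand z =
      γ * ((A (z 0) * B' (z 0) - A' (z 0) * B (z 0)) / (A (z 0) ^ 2 + B (z 0) ^ 2)))
    (hval : t.value = 0) : FibStokesDecomposable 1 t.integrand := by
  classical
  -- the square
  set S : Set (Fin 2 → ℝ) := Set.pi Set.univ (fun _ : Fin 2 => Set.Icc (0:ℝ) 1) with hS
  have hSsa : IsSemialgebraic ℚ S := by rw [hS, ← cube_eq_pi]; exact isSemialgebraic_cube
  have h12 : (1 : ℕ) ≤ 2 := by norm_num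
  have hx1 : ∀ x ∈ S, (fun l : Fin 1 => x (Fin.castLE h12 l)) ∈
      Set.pi Set.univ (fun _ : Fin 1 => Set.Icc (0:ℝ) 1) := fun x hx l _ => hx _ (Set.mem_univ _)
  -- the angular derivative
  set h : ℝ → ℝ := fun u => (A u * B' u - A' u * B u) / (A u ^ 2 + B u ^ 2) with hh
  have hti' : ∀ z ∈ Set.pi Set.univ (fun _ : Fin 1 => Set.Icc (0:ℝ) 1), t.integrand z = γ * h (z 0) :=
    fun z hz => by rw [hti z hz]
  -- trivial case `γ = 0`: no elements at all
  rcases eq_or_ne γ 0 with rfl | hγ0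
  · refine ⟨2, h12, 0, Fin.elim0, Fin.elim0, Fin.elim0, Fin.elim0, Fin.elim0, ∅, fun j => j.elim0,
      fun j => j.elim0, Literature.ModelTheory.ExponentialFields.isSemialgebraic_empty, measure_empty, ?_⟩
    intro x hx _
    rw [hti' _ (hx1 x hx)]
    simp
  -- Step 1: the value hypothesis says `∫₀¹ h = 0`
  have hcont_h : ContinuousOn h (Set.Icc (0:ℝ) 1) :=
    ((hAc.mul hB'c).sub (hA'c.mul hBc)).div ((hAc.pow 2).add (hBc.pow 2)) hAB
  have hint : ∫ u in (0:ℝ)..1, h u = 0 := by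
    have hmeas : MeasurableSet (Set.pi Set.univ (fun _ : Fin 1 => Set.Icc (0:ℝ) 1)) :=
      MeasurableSet.univ_pi fun _ => measurableSet_Icc
    have hv := hval
    rw [IntegralRep.value, ht, setIntegral_congr_fun hmeas hti',
      setIntegral_cubePi_one_eq (fun y => γ * h y), integral_Icc_eq_integral_Ioc,
      ← intervalIntegral.integral_of_le zero_le_one, intervalIntegral.integral_const_mul] at hv
    exact (mul_eq_zero.mp hv).resolve_left hγ0
  -- Step 2: a bound for `h` and the partition
  obtain ⟨M₀, hM₀⟩ := isCompact_Icc.exists_bound_of_continuousOn hcont_h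
  set M : ℝ := max M₀ 0 with hM
  have hM0 : 0 ≤ M := le_max_right _ _
  have hMb : ∀ u ∈ Set.Icc (0:ℝ) 1, |h u| ≤ M := fun u hu =>
    ((Real.norm_eq_abs _).symm.le.trans (hM₀ u hu)).trans (le_max_left _ _)
  obtain ⟨N, hN1, hpos, hMN, htan⟩ := stub_saPartition A B M hAc hBc hAB hM0
  have hNpos : (0:ℝ) < N := by exact_mod_cast hN1
  have hNne : (N:ℝ) ≠ 0 := hNpos.ne'
  -- Step 3: the grid and the re-centred loops
  set z : ℕ → ℝ := fun k => (k : ℝ) / N with hz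
  have hz_succ : ∀ k : ℕ, z (k + 1) = ((k : ℝ) + 1) / N := fun k => by simp [hz]
  have hz0 : z 0 = 0 := by simp [hz]
  have hzN : z N = 1 := by simp [hz, div_self hNne]
  have hz_le : ∀ k : ℕ, z k ≤ z (k + 1) := fun k => by
    rw [hz_succ]; exact div_le_div_of_nonneg_right (by linarith) hNpos.le
  have hz_lt : ∀ k : ℕ, z k < z (k + 1) := fun k => by
    rw [hz_succ]; exact div_lt_div_of_pos_right (by linarith) hNpos
  have hz_nonneg : ∀ k : ℕ, 0 ≤ z k := fun k => by positivity
  have hz_le_one : ∀ k : ℕ, k ≤ N → z k ≤ 1 := fun k hk => by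
    rw [div_le_one hNpos]; exact_mod_cast hk
  have hz_mem : ∀ k : ℕ, k ≤ N → z k ∈ Set.Icc (0:ℝ) 1 := fun k hk => ⟨hz_nonneg k, hz_le_one k hk⟩
  have hz_sub : ∀ k : ℕ, z (k + 1) - z k = 1 / N := fun k => by rw [hz_succ]; simp only [hz]; ring
  have hz_alg : ∀ k : ℕ, IsAlgebraic ℚ (z k) := fun k => isAlgebraic_natCast_div k N
  have hpiece_sub : ∀ k : ℕ, k < N → Set.Icc (z k) (z (k + 1)) ⊆ Set.Icc (0:ℝ) 1 := fun k hk u hu =>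
    ⟨(hz_nonneg k).trans hu.1, hu.2.trans (hz_le_one (k + 1) hk)⟩
  -- values of `A`, `B` at algebraic points of `[0,1]` are algebraic
  have hval_alg : ∀ (F : ℝ → ℝ),
      IsSemialgebraicFunOn ℚ (Set.pi Set.univ (fun _ : Fin 1 => Set.Icc (0:ℝ) 1)) (fun w => F (w 0)) →
      ∀ u ∈ Set.Icc (0:ℝ) 1, IsAlgebraic ℚ u → IsAlgebraic ℚ (F u) := fun F hF u hu hua =>
    hF.isAlgebraic_apply (a := fun _ => u) (fun _ _ => hu) fun _ => hua
  set a : ℕ → ℝ := fun k => A (z k) with ha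
  set b : ℕ → ℝ := fun k => B (z k) with hb
  have ha_alg : ∀ k, k ≤ N → IsAlgebraic ℚ (a k) := fun k hk => hval_alg A hA (z k) (hz_mem k hk) (hz_alg k)
  have hb_alg : ∀ k, k ≤ N → IsAlgebraic ℚ (b k) := fun k hk => hval_alg B hB (z k) (hz_mem k hk) (hz_alg k)
  have hab : ∀ k : ℕ, k ≤ N → a k ^ 2 + b k ^ 2 ≠ 0 := fun k hk => hAB _ (hz_mem k hk)
  set U : ℕ → ℝ → ℝ := fun k u => a k * A u + b k * B u with hU
  set W : ℕ → ℝ → ℝ := fun k u => a k * B u - b k * A u with hW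
  set U' : ℕ → ℝ → ℝ := fun k u => a k * A' u + b k * B' u with hU'
  set W' : ℕ → ℝ → ℝ := fun k u => a k * B' u - b k * A' u with hW'
  have hS1 : IsSemialgebraic ℚ (Set.pi Set.univ (fun _ : Fin 1 => Set.Icc (0:ℝ) 1)) := isSemialgebraic_cubePi_one
  have hlin : ∀ (c₁ c₂ : ℝ) (F₁ F₂ : ℝ → ℝ), IsAlgebraic ℚ c₁ → IsAlgebraic ℚ c₂ →
      IsSemialgebraicFunOn ℚ (Set.pi Set.univ (fun _ : Fin 1 => Set.Icc (0:ℝ) 1)) (fun w => F₁ (w 0)) →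
      IsSemialgebraicFunOn ℚ (Set.pi Set.univ (fun _ : Fin 1 => Set.Icc (0:ℝ) 1)) (fun w => F₂ (w 0)) →
      IsSemialgebraicFunOn ℚ (Set.pi Set.univ (fun _ : Fin 1 => Set.Icc (0:ℝ) 1)) (fun w => c₁ * F₁ (w 0) + c₂ * F₂ (w 0)) :=
    fun c₁ c₂ F₁ F₂ h₁ h₂ hF₁ hF₂ =>
      ((isSemialgebraicFunOn_const_of_isAlgebraic hS1 h₁).fun_mul hF₁).fun_add
        ((isSemialgebraicFunOn_const_of_isAlgebraic hS1 h₂).fun_mul hF₂)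
  have hlin' : ∀ (c₁ c₂ : ℝ) (F₁ F₂ : ℝ → ℝ), IsAlgebraic ℚ c₁ → IsAlgebraic ℚ c₂ →
      IsSemialgebraicFunOn ℚ (Set.pi Set.univ (fun _ : Fin 1 => Set.Icc (0:ℝ) 1)) (fun w => F₁ (w 0)) →
      IsSemialgebraicFunOn ℚ (Set.pi Set.univ (fun _ : Fin 1 => Set.Icc (0:ℝ) 1)) (fun w => F₂ (w 0)) →
      IsSemialgebraicFunOn ℚ (Set.pi Set.univ (fun _ : Fin 1 => Set.Icc (0:ℝ) 1)) (fun w => c₁ * F₁ (w 0) - c₂ * F₂ (w 0)) :=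
    fun c₁ c₂ F₁ F₂ h₁ h₂ hF₁ hF₂ =>
      ((isSemialgebraicFunOn_const_of_isAlgebraic hS1 h₁).fun_mul hF₁).fun_sub
        ((isSemialgebraicFunOn_const_of_isAlgebraic hS1 h₂).fun_mul hF₂)
  have hUsa : ∀ k, k ≤ N → IsSemialgebraicFunOn ℚ (Set.pi Set.univ (fun _ : Fin 1 => Set.Icc (0:ℝ) 1))
      (fun w => U k (w 0)) := fun k hk => hlin _ _ _ _ (ha_alg k hk) (hb_alg k hk) hA hB
  have hWsa : ∀ k, k ≤ N → IsSemialgebraicFunOn ℚ (Set.pi Set.univ (fun _ : Fin 1 => Set.Icc (0:ℝ) 1))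
      (fun w => W k (w 0)) := fun k hk => hlin' _ _ _ _ (ha_alg k hk) (hb_alg k hk) hB hA
  have hU'sa : ∀ k, k ≤ N → IsSemialgebraicFunOn ℚ (Set.pi Set.univ (fun _ : Fin 1 => Set.Icc (0:ℝ) 1))
      (fun w => U' k (w 0)) := fun k hk => hlin _ _ _ _ (ha_alg k hk) (hb_alg k hk) hA' hB'
  have hW'sa : ∀ k, k ≤ N → IsSemialgebraicFunOn ℚ (Set.pi Set.univ (fun _ : Fin 1 => Set.Icc (0:ℝ) 1))
      (fun w => W' k (w 0)) := fun k hk => hlin' _ _ _ _ (ha_alg k hk) (hb_alg k hk) hB' hA'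
  have hUc : ∀ k, ContinuousOn (U k) (Set.Icc (0:ℝ) 1) := fun k =>
    (continuousOn_const.mul hAc).add (continuousOn_const.mul hBc)
  have hWc : ∀ k, ContinuousOn (W k) (Set.Icc (0:ℝ) 1) := fun k =>
    (continuousOn_const.mul hBc).sub (continuousOn_const.mul hAc)
  have hU'c : ∀ k, ContinuousOn (U' k) (Set.Icc (0:ℝ) 1) := fun k =>
    (continuousOn_const.mul hA'c).add (continuousOn_const.mul hB'c)
  have hW'c : ∀ k, ContinuousOn (W' k) (Set.Icc (0:ℝ) 1) := fun k =>
    (continuousOn_const.mul hB'c).sub (continuousOn_const.mul hA'c)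
  have hUd : ∀ k, ∀ u ∈ Set.Ioo (0:ℝ) 1, HasDerivAt (U k) (U' k u) u := fun k u hu =>
    ((hAd u hu).const_mul (a k)).add ((hBd u hu).const_mul (b k))
  have hWd : ∀ k, ∀ u ∈ Set.Ioo (0:ℝ) 1, HasDerivAt (W k) (W' k u) u := fun k u hu =>
    ((hBd u hu).const_mul (a k)).sub ((hAd u hu).const_mul (b k))
  have hUpos : ∀ k : ℕ, k < N → ∀ u ∈ Set.Icc (z k) (z (k + 1)), 0 < U k u := by
    intro k hk u hu
    have hu' : u ∈ Set.Icc ((k:ℝ) / N) (((k:ℝ) + 1) / N) := by rwa [← hz_succ]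
    have := hpos k hk u hu'
    simp only [hU, ha, hb, hz]
    linarith [mul_comm (A u) (A ((k:ℝ) / N)), mul_comm (B u) (B ((k:ℝ) / N))]
  have hWz : ∀ k : ℕ, W k (z k) = 0 := fun k => by
    simp only [hW, ha, hb]; ring
  have hUW : ∀ k : ℕ, k ≤ N → ∀ u ∈ Set.Icc (0:ℝ) 1,
      (U k u * W' k u - U' k u * W k u) / (U k u ^ 2 + W k u ^ 2) = h u := by
    intro k hk u hu
    have h1 := hab k hk
    simp only [hU, hW, hU', hW', hh]
    have hden : (a k * A u + b k * B u) ^ 2 + (a k * B u - b k * A u) ^ 2 =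
        (a k ^ 2 + b k ^ 2) * (A u ^ 2 + B u ^ 2) := by ring
    have hnum : (a k * A u + b k * B u) * (a k * B' u - b k * A' u) - (a k * A' u + b k * B' u) * (a k * B u - b k * A u) =
        (a k ^ 2 + b k ^ 2) * (A u * B' u - A' u * B u) := by ring
    rw [hnum, hden, mul_div_mul_left _ _ h1]
  -- Step 4: the phase increments `φ k = arctan τ k = ∫_{z k}^{z (k+1)} h`
  set τ : ℕ → ℝ := fun k => W k (z (k + 1)) / U k (z (k + 1)) with hτ
  set φ : ℕ → ℝ := fun k => Real.arctan (τ k) with hφ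
  have hpiece_o : ∀ k : ℕ, k < N → Set.Ioo (z k) (z (k + 1)) ⊆ Set.Ioo (0:ℝ) 1 := fun k hk u hu =>
    ⟨(hz_nonneg k).trans_lt hu.1, hu.2.trans_le (hz_le_one (k + 1) hk)⟩
  have hφ_int : ∀ k : ℕ, k < N → φ k = ∫ u in (z k)..(z (k + 1)), h u := by
    intro k hk
    have hftc := stub_saArctanFTC (U k) (W k) (U' k) (W' k) (z k) (z (k + 1)) (hz_le k)
      ((hUc k).mono (hpiece_sub k hk)) ((hWc k).mono (hpiece_sub k hk))
      ((hU'c k).mono (hpiece_sub k hk)) ((hW'c k).mono (hpiece_sub k hk))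
      (fun u hu => hUd k u (hpiece_o k hk hu)) (fun u hu => hWd k u (hpiece_o k hk hu)) (hUpos k hk)
    rw [hWz k, zero_div, Real.arctan_zero, sub_zero] at hftc
    simp only [hφ, hτ]
    rw [hftc]
    refine intervalIntegral.integral_congr fun u hu => ?_
    rw [Set.uIcc_of_le (hz_le k)] at hu
    exact hUW k hk.le u (hpiece_sub k hk hu)
  have hφ_sum : ∑ k ∈ Finset.range N, φ k = 0 := by
    rw [Finset.sum_congr rfl fun k hk => hφ_int k (Finset.mem_range.mp hk),
      intervalIntegral.sum_integral_adjacent_intervals fun k hk =>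
        (hcont_h.mono (hpiece_sub k hk)).intervalIntegrable_of_Icc (hz_le k),
      hz0, hzN, hint]
  have hφ_bd : ∀ k : ℕ, k < N → |φ k| ≤ M / N := by
    intro k hk
    rw [hφ_int k hk]
    have := intervalIntegral.norm_integral_le_of_norm_le_const (a := z k) (b := z (k + 1)) (C := M)
      (f := h) fun u hu => ?_
    · rw [Real.norm_eq_abs, hz_sub, abs_of_pos (one_div_pos.mpr hNpos), ← div_eq_mul_one_div] at this
      exact this
    · rw [Set.uIoc_of_le (hz_le k)] at hu
      rw [Real.norm_eq_abs]
      exact hMb u (hpiece_sub k hk ⟨hu.1.le, hu.2⟩)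
  have hφ_lt : ∀ k : ℕ, k < N → |φ k| < Real.pi / 2 := fun k hk => (hφ_bd k hk).trans_lt hMN
  have hMN' : M / N < Real.pi / 2 := hMN
  -- Step 5: the cone estimate keeps the leftover loop in the right half-plane
  have hcone : ∀ y ∈ Set.Icc (0:ℝ) 1, |∑ k ∈ Finset.range N, Real.arctan (τ k * y)| < Real.pi / 2 := by
    intro y hy
    have h1 : ∀ k ∈ Finset.range N,
        |Real.arctan (τ k * y) - y * φ k| ≤ |φ k| * Real.tan (φ k) ^ 2 := fun k hk => by
      have htk : Real.arctan (τ k * y) = Real.arctan (y * Real.tan (φ k)) := by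
        simp only [hφ, Real.tan_arctan, mul_comm]
      rw [htk]
      exact stub_rungConeEstimate (φ k) y (hφ_lt k (Finset.mem_range.mp hk)) hy.1 hy.2
    have h2 : ∀ k ∈ Finset.range N, |φ k| * Real.tan (φ k) ^ 2 ≤ (M / N) * Real.tan (M / N) ^ 2 := by
      intro k hk
      have hk' := Finset.mem_range.mp hk
      refine mul_le_mul (hφ_bd k hk') ?_ (sq_nonneg _) (by positivity)
      have habs : Real.tan (φ k) ^ 2 = Real.tan |φ k| ^ 2 := by
        rcases le_total 0 (φ k) with h0 | h0
        · rw [abs_of_nonneg h0]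
        · rw [abs_of_nonpos h0, Real.tan_neg, neg_sq]
      rw [habs]
      refine rungConeEstimate_tan_sq_le (by linarith [Real.pi_pos, hM0, (by positivity : 0 ≤ M / N)]) hMN' ?_
      rw [Set.uIcc_of_le (by positivity)]
      exact ⟨abs_nonneg _, hφ_bd k hk'⟩
    calc |∑ k ∈ Finset.range N, Real.arctan (τ k * y)|
        = |∑ k ∈ Finset.range N, (Real.arctan (τ k * y) - y * φ k) + y * ∑ k ∈ Finset.range N, φ k| := by
          rw [Finset.mul_sum, ← Finset.sum_add_distrib]
          simp only [sub_add_cancel]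
      _ = |∑ k ∈ Finset.range N, (Real.arctan (τ k * y) - y * φ k)| := by rw [hφ_sum, mul_zero, add_zero]
      _ ≤ ∑ k ∈ Finset.range N, |Real.arctan (τ k * y) - y * φ k| := Finset.abs_sum_le_sum_abs _ _
      _ ≤ ∑ k ∈ Finset.range N, |φ k| * Real.tan (φ k) ^ 2 := Finset.sum_le_sum h1
      _ ≤ ∑ k ∈ Finset.range N, (M / N) * Real.tan (M / N) ^ 2 := Finset.sum_le_sum h2
      _ = M * Real.tan (M / N) ^ 2 := by
          rw [Finset.sum_const, Finset.card_range, nsmul_eq_mul]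
          field_simp
      _ < Real.pi / 2 := htan
  -- Step 6: the leftover loop `Q(y) = Π (1 + i τ_k y)` as real polynomials
  have hτ_alg : ∀ k, k < N → IsAlgebraic ℚ (τ k) := by
    intro k hk
    have hWv : IsAlgebraic ℚ (W k (z (k + 1))) := hval_alg _ (hWsa k hk.le) _ (hz_mem (k + 1) hk) (hz_alg (k + 1))
    have hUv : IsAlgebraic ℚ (U k (z (k + 1))) := hval_alg _ (hUsa k hk.le) _ (hz_mem (k + 1) hk) (hz_alg (k + 1))
    exact mem_algebraicClosure_iff.mp
      (div_mem (mem_algebraicClosure_iff.mpr hWv) (mem_algebraicClosure_iff.mpr hUv))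
  obtain ⟨AQ, BQ, hAQc, hBQc, hAQ, hBQ, hnorm, hlog⟩ := stub_rungLeftoverLoop N τ hτ_alg
  have hR_pos : ∀ y : ℝ, 0 < ∏ k ∈ Finset.range N, Real.sqrt (1 + (τ k * y) ^ 2) := fun y =>
    Finset.prod_pos fun k _ => Real.sqrt_pos.2 (by positivity)
  have hP_pos : ∀ y : ℝ, 0 < ∏ k ∈ Finset.range N, (1 + (τ k * y) ^ 2) := fun y =>
    Finset.prod_pos fun k _ => by positivity
  have hAQpos : ∀ y ∈ Set.Icc (0:ℝ) 1, 0 < AQ.eval y := by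
    intro y hy
    rw [hAQ]
    have hc := abs_lt.mp (hcone y hy)
    exact mul_pos (hR_pos y) (Real.cos_pos_of_mem_Ioo ⟨by linarith [hc.1], hc.2⟩)
  have hBQ0 : BQ.eval 0 = 0 := by rw [hBQ]; simp
  have hBQ1 : BQ.eval 1 = 0 := by
    rw [hBQ]
    simp only [mul_one]
    rw [show ∑ k ∈ Finset.range N, Real.arctan (τ k) = ∑ k ∈ Finset.range N, φ k from rfl, hφ_sum,
      Real.sin_zero, mul_zero]
  have hQid : ∀ y : ℝ, (AQ.eval y * (Polynomial.derivative BQ).eval y -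
      (Polynomial.derivative AQ).eval y * BQ.eval y) / (AQ.eval y ^ 2 + BQ.eval y ^ 2) =
      ∑ k ∈ Finset.range N, τ k / (1 + (τ k * y) ^ 2) := fun y => by
    rw [hlog, hnorm, mul_div_cancel_left₀ _ (hP_pos y).ne']
  -- Step 7: rung 3 in swapped coordinates absorbs the leftover
  obtain ⟨G2, D2, q2, hGD2, hq2, hid2⟩ := stub_rungAngularCertificateSwap γ (fun u => AQ.eval u)
    (fun u => BQ.eval u) (fun u => (Polynomial.derivative AQ).eval u) (fun u => (Polynomial.derivative BQ).eval u)
    hγ (isSemialgebraicFunOn_eval_apply hSsa hAQc 1) (isSemialgebraicFunOn_eval_apply hSsa hBQc 1)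
    (isSemialgebraicFunOn_eval_apply hSsa (isAlgebraic_coeff_derivative hAQc) 1)
    (isSemialgebraicFunOn_eval_apply hSsa (isAlgebraic_coeff_derivative hBQc) 1)
    hAQpos hBQ0 hBQ1 AQ.continuousOn BQ.continuousOn (Polynomial.derivative AQ).continuousOn
    (Polynomial.derivative BQ).continuousOn (fun u _ => AQ.hasDerivAt u) (fun u _ => BQ.hasDerivAt u)
  -- Step 8: one clamped certificate per piece
  have hpiece : ∀ k : Fin N, ∃ (G D : Fin 2 → (Fin 2 → ℝ) → ℝ) (K : Fin 2 → Set (Fin 2 → ℝ))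
      (q : Fin 2 → IntegralRep 2),
      (∀ j, IsSemialgebraicFunOn ℚ S (G j) ∧ IsSemialgebraicFunOn ℚ S (D j) ∧ IsSemialgebraic ℚ (K j) ∧
        (∃ B : ℝ, ∀ x ∈ S, |(G j) x| ≤ B) ∧
        (∀ x ∈ S, Set.Finite {s : ℝ | Function.update x j s ∈ (K j)}) ∧
        (∀ x ∈ S, ContinuousOn (fun s : ℝ => (G j) (Function.update x j s)) (Set.Icc (0:ℝ) 1)) ∧
        (∀ x ∈ S, x ∉ (K j) → x j ∈ Set.Ioo (0:ℝ) 1 →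
          HasDerivAt (fun s : ℝ => (G j) (Function.update x j s)) ((D j) x) (x j))) ∧
      (∀ j, (q j).domain = S ∧ ∀ x ∈ S, (q j).integrand x =
        D j x - (G j (Function.update x j 1) - G j (Function.update x j 0))) ∧
      ∀ x ∈ S, ∑ j, (q j).integrand x =
        γ * (if z k < x 0 ∧ x 0 < z (k + 1) then
            (U k (x 0) * W' k (x 0) - U' k (x 0) * W k (x 0)) / (U k (x 0) ^ 2 + W k (x 0) ^ 2)
          else 0) -
        γ * (U k (z (k + 1)) * W k (z (k + 1))) /
          (U k (z (k + 1)) ^ 2 + W k (z (k + 1)) ^ 2 * x 1 ^ 2) := fun k =>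
    stub_saClampedAngularCertificate γ (z k) (z (k + 1)) (U k) (W k) (U' k) (W' k) hγ (hz_alg k) (hz_alg (k + 1))
      (hUsa k k.2.le) (hWsa k k.2.le) (hU'sa k k.2.le) (hW'sa k k.2.le) (hUc k) (hWc k) (hU'c k) (hW'c k)
      (hUd k) (hWd k) (hz_nonneg k) (hz_lt k) (hz_le_one (k + 1) k.2) (hUpos k k.2) (hWz k)
  choose G1 D1 K1 q1 hGD1 hq1 hid1 using hpiece
  -- Step 9: the null grid
  set Z : Set (Fin 2 → ℝ) := ⋃ k ∈ Finset.range (N + 1), {x : Fin 2 → ℝ | x 0 = z k} with hZ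
  have hZsa : IsSemialgebraic ℚ Z :=
    Literature.ModelTheory.ExponentialFields.IsSemialgebraic.biUnion (k := ℚ) (Finset.range (N + 1))
      (fun k => {x : Fin 2 → ℝ | x 0 = z k}) fun k _ => isSemialgebraic_setOf_apply_eq_of_isAlgebraic (hz_alg k) 0
  have hZvol : volume Z = 0 :=
    (measure_biUnion_null_iff (Finset.range (N + 1)).countable_toSet).mpr fun k _ => by
      rw [volume_pi]; exact Measure.pi_hyperplane _ _ _
  -- Step 10: assembling the `2N + 2` elements
  let ι := (Fin N × Fin 2) ⊕ Fin 2
  let e : Fin (N * 2 + 2) ≃ ι :=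
    finSumFinEquiv.symm.trans (Equiv.sumCongr finProdFinEquiv.symm (Equiv.refl (Fin 2)))
  let dir : ι → Fin 2 := Sum.elim (fun p => p.2) (fun j => Fin.rev j)
  let Gι : ι → (Fin 2 → ℝ) → ℝ := Sum.elim (fun p => G1 p.1 p.2) (fun j => G2 j)
  let Dι : ι → (Fin 2 → ℝ) → ℝ := Sum.elim (fun p => D1 p.1 p.2) (fun j => D2 j)
  let Kι : ι → Set (Fin 2 → ℝ) := Sum.elim (fun p => K1 p.1 p.2) (fun _ => ∅)
  let qι : ι → IntegralRep 2 := Sum.elim (fun p => q1 p.1 p.2) (fun j => q2 j)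
  have hcond : ∀ s : ι, IsSemialgebraicFunOn ℚ S (Gι s) ∧ IsSemialgebraicFunOn ℚ S (Dι s) ∧
      IsSemialgebraic ℚ (Kι s) ∧ (∃ B : ℝ, ∀ x ∈ S, |(Gι s) x| ≤ B) ∧
      (∀ x ∈ S, Set.Finite {s' : ℝ | Function.update x (dir s) s' ∈ (Kι s)}) ∧
      (∀ x ∈ S, ContinuousOn (fun s' : ℝ => (Gι s) (Function.update x (dir s) s')) (Set.Icc (0:ℝ) 1)) ∧
      (∀ x ∈ S, x ∉ (Kι s) → x (dir s) ∈ Set.Ioo (0:ℝ) 1 →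
        HasDerivAt (fun s' : ℝ => (Gι s) (Function.update x (dir s) s')) ((Dι s) x) (x (dir s))) := by
    rintro (⟨k, j'⟩ | j')
    · exact hGD1 k j'
    · obtain ⟨h1, h2, h3, h4, h5⟩ := hGD2 j'
      exact ⟨h1, h2, Literature.ModelTheory.ExponentialFields.isSemialgebraic_empty, h3,
        fun x _ => by simp [Kι], h4, fun x hx _ hxj => h5 x hx hxj⟩
  have hqc : ∀ s : ι, (qι s).domain = S ∧ ∀ x ∈ S, (qι s).integrand x =
      Dι s x - (Gι s (Function.update x (dir s) 1) - Gι s (Function.update x (dir s) 0)) := by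
    rintro (⟨k, j'⟩ | j')
    · exact hq1 k j'
    · exact hq2 j'
  refine ⟨2, h12, N * 2 + 2, fun j => dir (e j), fun j => Gι (e j), fun j => Dι (e j), fun j => Kι (e j),
    fun j => qι (e j), Z, fun j => hcond (e j), fun j => hqc (e j), hZsa, hZvol, fun x hx hxZ => ?_⟩
  -- the decomposition off the grid
  · have hx0 : x 0 ∈ Set.Icc (0:ℝ) 1 := hx 0 (Set.mem_univ _)
    have hgrid : ∀ k : ℕ, k ≤ N → x 0 ≠ z k := by
      intro k hk hxk
      exact hxZ (Set.mem_iUnion₂.mpr ⟨k, Finset.mem_range.mpr (Nat.lt_succ_of_le hk), hxk⟩)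
    obtain ⟨k₀, hk₀N, hk₀in, hk₀uniq⟩ := exists_unique_piece hN1 hx0 hgrid
    rw [hti' _ (hx1 x hx)]
    have hsum : ∑ j : Fin (N * 2 + 2), (qι (e j)).integrand x = ∑ s : ι, (qι s).integrand x :=
      Equiv.sum_comp e (fun s => (qι s).integrand x)
    rw [hsum, Fintype.sum_sum_type, Fintype.sum_prod_type]
    simp only [qι, Sum.elim_inl, Sum.elim_inr]
    rw [Finset.sum_congr rfl fun k _ => hid1 k x hx, ← hid2 x hx, hQid (x 1), Finset.sum_sub_distrib]
    -- the clamped pieces reproduce `γ h (x 0)` exactly once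
    have hone : ∑ k : Fin N, γ * (if z k < x 0 ∧ x 0 < z (k + 1) then
        (U k (x 0) * W' k (x 0) - U' k (x 0) * W k (x 0)) / (U k (x 0) ^ 2 + W k (x 0) ^ 2) else 0) =
        γ * h (x 0) := by
      rw [Finset.sum_eq_single ⟨k₀, hk₀N⟩]
      · simp only
        rw [if_pos (by simpa [hz, hz_succ] using hk₀in), hUW k₀ hk₀N.le _ hx0]
      · intro k _ hk
        rw [if_neg, mul_zero]
        intro hcond
        apply hk
        ext
        exact hk₀uniq k (by simpa [hz, hz_succ] using hcond)
      · intro hk; exact absurd (Finset.mem_univ _) hk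
    -- the leftovers are the half-angle kernels of the loop `Q`
    have hleft : ∑ k : Fin N, γ * (U k (z (k + 1)) * W k (z (k + 1))) /
        (U k (z (k + 1)) ^ 2 + W k (z (k + 1)) ^ 2 * x 1 ^ 2) =
        γ * ∑ k ∈ Finset.range N, τ k / (1 + (τ k * x 1) ^ 2) := by
      rw [Finset.mul_sum, ← Fin.sum_univ_eq_sum_range]
      refine Finset.sum_congr rfl fun k _ => ?_
      have hUk : U k (z (k + 1)) ≠ 0 := (hUpos k k.2 _ ⟨hz_le k, le_rfl⟩).ne'
      rw [mul_div_assoc, leftover_eq_halfAngle hUk]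
    show γ * h ((fun l : Fin 1 => x (Fin.castLE h12 l)) 0) = _
    rw [hone, hleft]
    show γ * h (x 0) = _
    ring



end Summit.KontsevichZagierPeriods.KontsevichZagierPeriods.Cruxes.StokesGeneration.FibrewiseStokes

end
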